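import Summits.ValiantsHypothesis.ValiantsHypothesis.Theorems.SymPencilPerFourHyperplanePencilDispatch

/-!
# Route `SymPencil` — the one-row pencil core of hyperplane flow rigidity, XIV: the generic
# one-zero family and the UNCONDITIONAL S1c (tool file, `--supports` stmt-ValiantsHypothesis-5674;
# nothing here bears on `VP ≠ VNP`)

The last family of PART X (memo `Cruxes/SdcSuperquadratic/CELL-TWELVE-FOUR.md` §6 (b)):
`μ = (m₀, m₁, m₂, 0)` with `m₀ m₁ m₂ ≠ 0`.  `eq_zero_of_pencil_flow_one_zero`: if moreover
`m₁ + m₂ ≠ 0`, `m₀ + m₂ ≠ 0` and not `m₀ = m₁ = m₂`, then `X₂ = 0` on `ker μ`.  Proof (by hand, as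
in `SymPencilPerFourHyperplanePencilSym`): the columns `0,1,2` of `S = X₀ + X₁` are diagonal
(`S e_i = σ_i e_i`), the column `3` is `S e₃ = σ₃ e₃ + ρ (s/2 − m₀, s/2 − m₁, s/2 − m₂, 0)`
(`s = m₀+m₁+m₂`) by the zero-diagonal condition; the two pairing functionals of (F1) are multiples
`κ μ`, `κ' μ` with `κ (m₁+m₂) = 0 = κ' (m₀+m₂)`, whence `σ₀ = σ₁ = σ₂ = σ₃`, `ρ = 0`, `S = σ·1`,
`X₂ = −σ` on `ker μ` and `σ = 0` by nilpotency.  The hypothesis `hgen` of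
`SymPencilPerFourHyperplanePencilDispatch` follows (`hgen_holds`: a zero-sum pair among the three
non-zero coordinates is moved to `{0,1}` by a permutation), and with it the UNCONDITIONAL stub S1c:
`exists_kernel_hyperplane_of_pencil_flow` (signature of record, vw bus 14:50Z) and the good point
`exists_good_point_of_pencil_flow` of `RIG_𝟙`.  Elementary. [folklore]
-/

-- single-conjunct layout: Sub = Summit, duplicated namespace component intended
set_option linter.dupNamespace false

namespace Summit.ValiantsHypothesis.ValiantsHypothesis.Theorems.SymPencilPerFourHyperplanePencilZeroOne

open Matrix
open Summit.ValiantsHypothesis.ValiantsHypothesis.Theorems.SymPencilPerFourInnerRankRows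
  (permanent_of_rows)
open Summit.ValiantsHypothesis.ValiantsHypothesis.Theorems.SymPencilPerFourBoxInjective
  (apply_eq_dotProduct)
open Summit.ValiantsHypothesis.ValiantsHypothesis.Theorems.SymPencilPerFourHyperplanePencilOrders
open Summit.ValiantsHypothesis.ValiantsHypothesis.Theorems.SymPencilPerFourHyperplanePencilRankOneA
  (per_last_eq_dotProduct exists_coeff_of_vanish per_single_single apply_eq_sum_single)
open Summit.ValiantsHypothesis.ValiantsHypothesis.Theorems.SymPencilPerFourHyperplanePencilSym
open Summit.ValiantsHypothesis.ValiantsHypothesis.Theorems.SymPencilPerFourHyperplanePencilPerm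
open Summit.ValiantsHypothesis.ValiantsHypothesis.Theorems.SymPencilPerFourHyperplanePencilNonzero
  (pencil_flow_conj X₂_eq_zero_of_conj)
open Summit.ValiantsHypothesis.ValiantsHypothesis.Theorems.SymPencilPerFourHyperplanePencilDispatch
open Summit.ValiantsHypothesis.ValiantsHypothesis.Theorems.SymPencilPerFourBoxNonvanishing
  (exists_box_point)

variable {K : Type*} [Field K] [CharZero K]

/-- **Symmetrised (F1) at `(e_i, e_k)` for two diagonal columns** (only `μ(e_i), μ(e_k) ≠ 0`
needed). [folklore] -/
theorem pair_identity₂ (X₀ X₁ X₂ : (Fin 4 → K) →ₗ[K] (Fin 4 → K)) (μ : (Fin 4 → K) →ₗ[K] K)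
    (h : ∀ (a b c : Fin 4 → K) (t : K), μ c = 0 →
      (Matrix.of ![(fun _ => (1 : K)), a + t • X₀ a, b + t • X₁ b, c + t • X₂ c]).permanent =
        (Matrix.of ![(fun _ => (1 : K)), a, b, c]).permanent)
    (i k : Fin 4) (hi : μ (Pi.single i 1) ≠ 0) (hk : μ (Pi.single k 1) ≠ 0) (c : Fin 4 → K)
    (hc : μ c = 0) :
    ((X₀ (Pi.single i 1) + X₁ (Pi.single i 1)) i + (X₀ (Pi.single k 1) + X₁ (Pi.single k 1)) k) *
        (Matrix.of ![(fun _ => (1 : K)), Pi.single i 1, Pi.single k 1, c]).permanent +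
      2 * (Matrix.of ![(fun _ => (1 : K)), Pi.single i 1, Pi.single k 1, X₂ c]).permanent = 0 := by
  have h1 := (pencil_flow_orders X₀ X₁ X₂ μ h (Pi.single i 1) (Pi.single k 1) c hc).1
  have h2 := (pencil_flow_orders X₀ X₁ X₂ μ h (Pi.single k 1) (Pi.single i 1) c hc).1
  rw [per_swap₁₂ (Pi.single i 1) (X₁ _)] at h1
  rw [per_swap₁₂ (Pi.single k 1) (X₁ _), per_swap₁₂ (Pi.single k 1) (Pi.single i 1)] at h2
  have hSi := S_single_eq_smul X₀ X₁ X₂ μ h i hi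
  have hSk := S_single_eq_smul X₀ X₁ X₂ μ h k hk
  have eI : (Matrix.of ![(fun _ => (1 : K)), X₀ (Pi.single i 1), Pi.single k 1, c]).permanent +
      (Matrix.of ![(fun _ => (1 : K)), X₁ (Pi.single i 1), Pi.single k 1, c]).permanent =
      (X₀ (Pi.single i 1) + X₁ (Pi.single i 1)) i *
        (Matrix.of ![(fun _ => (1 : K)), Pi.single i 1, Pi.single k 1, c]).permanent := by
    rw [← per_add₁, hSi, per_smul₁]; simp
  have eK : (Matrix.of ![(fun _ => (1 : K)), X₀ (Pi.single k 1), Pi.single i 1, c]).permanent +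
      (Matrix.of ![(fun _ => (1 : K)), X₁ (Pi.single k 1), Pi.single i 1, c]).permanent =
      (X₀ (Pi.single k 1) + X₁ (Pi.single k 1)) k *
        (Matrix.of ![(fun _ => (1 : K)), Pi.single i 1, Pi.single k 1, c]).permanent := by
    rw [← per_add₁, hSk, per_smul₁, per_swap₁₂ (Pi.single k 1)]; simp
  linear_combination h1 + h2 - eI - eK

/-- **Symmetrised (F1) at `(e_i, e₃)`** with the column `3` of `S` written out:
`σ_i T(e_i,e₃,c) + T(S e₃, e_i, c) + 2 T(e_i, e₃, X₂ c) = 0`. [folklore] -/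
theorem pair_identity₃ (X₀ X₁ X₂ : (Fin 4 → K) →ₗ[K] (Fin 4 → K)) (μ : (Fin 4 → K) →ₗ[K] K)
    (h : ∀ (a b c : Fin 4 → K) (t : K), μ c = 0 →
      (Matrix.of ![(fun _ => (1 : K)), a + t • X₀ a, b + t • X₁ b, c + t • X₂ c]).permanent =
        (Matrix.of ![(fun _ => (1 : K)), a, b, c]).permanent)
    (i : Fin 4) (hi : μ (Pi.single i 1) ≠ 0) (c : Fin 4 → K) (hc : μ c = 0) :
    (X₀ (Pi.single i 1) + X₁ (Pi.single i 1)) i *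
        (Matrix.of ![(fun _ => (1 : K)), Pi.single i 1, Pi.single 3 1, c]).permanent +
      (Matrix.of ![(fun _ => (1 : K)), X₀ (Pi.single 3 1) + X₁ (Pi.single 3 1), Pi.single i 1,
        c]).permanent +
      2 * (Matrix.of ![(fun _ => (1 : K)), Pi.single i 1, Pi.single 3 1, X₂ c]).permanent = 0 := by
  have h1 := (pencil_flow_orders X₀ X₁ X₂ μ h (Pi.single i 1) (Pi.single 3 1) c hc).1
  have h2 := (pencil_flow_orders X₀ X₁ X₂ μ h (Pi.single 3 1) (Pi.single i 1) c hc).1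
  rw [per_swap₁₂ (Pi.single i 1) (X₁ _)] at h1
  rw [per_swap₁₂ (Pi.single 3 1) (X₁ _), per_swap₁₂ (Pi.single 3 1) (Pi.single i 1)] at h2
  have hSi := S_single_eq_smul X₀ X₁ X₂ μ h i hi
  have eI : (Matrix.of ![(fun _ => (1 : K)), X₀ (Pi.single i 1), Pi.single 3 1, c]).permanent +
      (Matrix.of ![(fun _ => (1 : K)), X₁ (Pi.single i 1), Pi.single 3 1, c]).permanent =
      (X₀ (Pi.single i 1) + X₁ (Pi.single i 1)) i *
        (Matrix.of ![(fun _ => (1 : K)), Pi.single i 1, Pi.single 3 1, c]).permanent := by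
    rw [← per_add₁, hSi, per_smul₁]; simp
  have eK : (Matrix.of ![(fun _ => (1 : K)), X₀ (Pi.single 3 1), Pi.single i 1, c]).permanent +
      (Matrix.of ![(fun _ => (1 : K)), X₁ (Pi.single 3 1), Pi.single i 1, c]).permanent =
      (Matrix.of ![(fun _ => (1 : K)), X₀ (Pi.single 3 1) + X₁ (Pi.single 3 1), Pi.single i 1,
        c]).permanent := by
    rw [← per_add₁]
  linear_combination h1 + h2 - eI - eK

/-- **PART X for the generic one-zero family**: `μ = (m₀, m₁, m₂, 0)` with `m₀m₁m₂ ≠ 0`,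
`m₁ + m₂ ≠ 0`, `m₀ + m₂ ≠ 0` and not `m₀ = m₁ = m₂` forces `X₂ = 0` on `ker μ`. [folklore] -/
theorem eq_zero_of_pencil_flow_one_zero (X₀ X₁ X₂ : (Fin 4 → K) →ₗ[K] (Fin 4 → K))
    (μ : (Fin 4 → K) →ₗ[K] K) (hm0 : μ (Pi.single 0 1) ≠ 0) (hm1 : μ (Pi.single 1 1) ≠ 0)
    (hm2 : μ (Pi.single 2 1) ≠ 0) (hm3 : μ (Pi.single 3 1) = 0)
    (h12 : μ (Pi.single 1 1) + μ (Pi.single 2 1) ≠ 0)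
    (h02 : μ (Pi.single 0 1) + μ (Pi.single 2 1) ≠ 0)
    (hne : ¬ (μ (Pi.single 1 1) = μ (Pi.single 0 1) ∧ μ (Pi.single 2 1) = μ (Pi.single 0 1)))
    (h : ∀ (a b c : Fin 4 → K) (t : K), μ c = 0 →
      (Matrix.of ![(fun _ => (1 : K)), a + t • X₀ a, b + t • X₁ b, c + t • X₂ c]).permanent =
        (Matrix.of ![(fun _ => (1 : K)), a, b, c]).permanent)
    (c : Fin 4 → K) (hc : μ c = 0) : X₂ c = 0 := by
  -- diagonal columns 0, 1, 2
  obtain ⟨σ, hσ⟩ : ∃ σ : Fin 4 → K, ∀ i, (X₀ (Pi.single i 1) + X₁ (Pi.single i 1)) i = σ i :=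
    ⟨_, fun i => rfl⟩
  have hS0 : X₀ (Pi.single 0 1) + X₁ (Pi.single 0 1) = σ 0 • Pi.single 0 1 := by
    rw [← hσ 0]; exact S_single_eq_smul X₀ X₁ X₂ μ h 0 hm0
  have hS1 : X₀ (Pi.single 1 1) + X₁ (Pi.single 1 1) = σ 1 • Pi.single 1 1 := by
    rw [← hσ 1]; exact S_single_eq_smul X₀ X₁ X₂ μ h 1 hm1
  have hS2 : X₀ (Pi.single 2 1) + X₁ (Pi.single 2 1) = σ 2 • Pi.single 2 1 := by
    rw [← hσ 2]; exact S_single_eq_smul X₀ X₁ X₂ μ h 2 hm2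
  -- column 3: `x = S e₃ = (ρ(s/2 - m₀), ρ(s/2 - m₁), ρ(s/2 - m₂), x₃)`
  obtain ⟨x, hx⟩ : ∃ x : Fin 4 → K, X₀ (Pi.single 3 1) + X₁ (Pi.single 3 1) = x := ⟨_, rfl⟩
  have hxc : ∀ c', μ c' = 0 →
      (Matrix.of ![(fun _ => (1 : K)), x, Pi.single 3 1, c']).permanent = 0 := fun c' hc' => by
    have h1 := (pencil_flow_orders X₀ X₁ X₂ μ h (Pi.single 3 1) (Pi.single 3 1) c' hc').1
    rw [per_single_self, add_zero, per_swap₁₂ (Pi.single 3 1), ← per_add₁, hx] at h1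
    exact h1
  obtain ⟨ρ, hρ⟩ := exists_coeff_of_vanish μ
    (fun q => (Matrix.of ![(fun _ => (1 : K)), x, Pi.single 3 1, Pi.single q 1]).permanent)
    fun c' hc' => by have h0 := hxc c' hc'; rw [per_last_eq_dotProduct] at h0; exact h0
  have r0 := hρ 0; have r1 := hρ 1; have r2 := hρ 2
  rw [per_single_single, if_neg (by decide)] at r0 r1 r2
  set m0 := μ (Pi.single 0 1) with hm0d
  set m1 := μ (Pi.single 1 1) with hm1d
  set m2 := μ (Pi.single 2 1) with hm2d
  have x0 : x 0 = ρ * ((m0 + m1 + m2) / 2 - m0) := by linear_combination (r1 + r2 - r0) / 2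
  have x1 : x 1 = ρ * ((m0 + m1 + m2) / 2 - m1) := by linear_combination (r0 + r2 - r1) / 2
  have x2 : x 2 = ρ * ((m0 + m1 + m2) / 2 - m2) := by linear_combination (r0 + r1 - r2) / 2
  -- the two pairing functionals
  have G : ∀ c', μ c' = 0 →
      ((σ 2 - σ 1 + ρ * (m2 - m1)) * c' 0 + (x 3 - σ 0 + ρ * ((m1 + m2 - m0) / 2)) * c' 1 +
        (σ 0 - x 3 - ρ * ((m1 + m2 - m0) / 2)) * c' 2 + (σ 1 - σ 2 + ρ * (m2 - m1)) * c' 3 = 0 ∧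
       (x 3 - σ 1 + ρ * ((m0 + m2 - m1) / 2)) * c' 0 + (σ 2 - σ 0 + ρ * (m2 - m0)) * c' 1 +
        (σ 1 - x 3 - ρ * ((m0 + m2 - m1) / 2)) * c' 2 + (σ 0 - σ 2 + ρ * (m2 - m0)) * c' 3 = 0) := by
    intro c' hc'
    have q01 := pair_identity₂ X₀ X₁ X₂ μ h 0 1 hm0 hm1 c' hc'
    have q02 := pair_identity₂ X₀ X₁ X₂ μ h 0 2 hm0 hm2 c' hc'
    have q12 := pair_identity₂ X₀ X₁ X₂ μ h 1 2 hm1 hm2 c' hc'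
    have q03 := pair_identity₃ X₀ X₁ X₂ μ h 0 hm0 c' hc'
    have q13 := pair_identity₃ X₀ X₁ X₂ μ h 1 hm1 c' hc'
    have q23 := pair_identity₃ X₀ X₁ X₂ μ h 2 hm2 c' hc'
    rw [hσ, hσ] at q01 q02 q12
    rw [hσ, hx] at q03 q13 q23
    rw [per_last_eq_dotProduct (Pi.single _ 1) (Pi.single _ 1) c',
      per_last_eq_dotProduct (Pi.single _ 1) (Pi.single _ 1) (X₂ c')] at q01 q02 q12 q03 q13 q23
    rw [per_last_eq_dotProduct x] at q03 q13 q23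
    simp only [dotProduct, Fin.sum_univ_four, per_single_single] at q01 q02 q12 q03 q13 q23
    simp at q01 q02 q12 q03 q13 q23
    rw [x0, x1, x2] at q03 q13 q23
    constructor
    · linear_combination q01 + q23 - q02 - q13
    · linear_combination q01 + q23 - q03 - q12
  obtain ⟨κ, hκ⟩ := exists_coeff_of_vanish μ
    ![σ 2 - σ 1 + ρ * (m2 - m1), x 3 - σ 0 + ρ * ((m1 + m2 - m0) / 2),
      σ 0 - x 3 - ρ * ((m1 + m2 - m0) / 2), σ 1 - σ 2 + ρ * (m2 - m1)]
    fun c' hc' => by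
      rw [dotProduct, Fin.sum_univ_four]
      simp only [Matrix.cons_val_zero, Matrix.cons_val_one, Matrix.cons_val]
      linear_combination (G c' hc').1
  obtain ⟨κ', hκ'⟩ := exists_coeff_of_vanish μ
    ![x 3 - σ 1 + ρ * ((m0 + m2 - m1) / 2), σ 2 - σ 0 + ρ * (m2 - m0),
      σ 1 - x 3 - ρ * ((m0 + m2 - m1) / 2), σ 0 - σ 2 + ρ * (m2 - m0)]
    fun c' hc' => by
      rw [dotProduct, Fin.sum_univ_four]
      simp only [Matrix.cons_val_zero, Matrix.cons_val_one, Matrix.cons_val]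
      linear_combination (G c' hc').2
  have k0 := hκ 0; have k1 := hκ 1; have k2 := hκ 2; have k3 := hκ 3
  have l0 := hκ' 0; have l1 := hκ' 1; have l2 := hκ' 2; have l3 := hκ' 3
  simp only [Matrix.cons_val_zero, Matrix.cons_val_one, Matrix.cons_val] at k0 k1 k2 k3 l0 l1 l2 l3
  rw [← hm0d] at k0 l0
  rw [← hm1d] at k1 l1
  rw [← hm2d] at k2 l2
  rw [hm3, mul_zero] at k3 l3
  -- `κ = κ' = 0`
  have hk : κ = 0 := by
    have : κ * (m1 + m2) = 0 := by linear_combination -(k1 + k2)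
    exact (mul_eq_zero.1 this).resolve_right h12
  have hk' : κ' = 0 := by
    have : κ' * (m0 + m2) = 0 := by linear_combination -(l0 + l2)
    exact (mul_eq_zero.1 this).resolve_right h02
  rw [hk, zero_mul] at k0 k1 k2
  rw [hk', zero_mul] at l0 l1 l2
  have e21 : σ 2 = σ 1 := by linear_combination (k0 - k3) / 2
  have e20 : σ 2 = σ 0 := by linear_combination (l1 - l3) / 2
  have hρ : ρ = 0 := by
    by_contra hρ
    have f1 : m2 = m1 := by
      have : ρ * (m2 - m1) = 0 := by linear_combination (k0 + k3) / 2
      have := (mul_eq_zero.1 this).resolve_left hρ; linear_combination this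
    have f0 : m2 = m0 := by
      have : ρ * (m2 - m0) = 0 := by linear_combination (l1 + l3) / 2
      have := (mul_eq_zero.1 this).resolve_left hρ; linear_combination this
    exact hne ⟨by rw [← f1, f0], f0⟩
  rw [hρ] at k1 x0 x1 x2
  have e30 : x 3 = σ 0 := by linear_combination k1
  -- `S = σ₀ · 1`
  have hS3 : X₀ (Pi.single 3 1) + X₁ (Pi.single 3 1) = σ 0 • Pi.single 3 1 := by
    rw [hx]; funext j
    fin_cases j
    · simp [x0]
    · simp [x1]
    · simp [x2]
    · simp [e30]
  have hX1 : ∀ a, X₁ a = σ 0 • a - X₀ a := fun a => by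
    have hSa : X₀ a + X₁ a = σ 0 • a := by
      rw [apply_eq_sum_single X₀ a, apply_eq_sum_single X₁ a]
      have ha : a = a 0 • (Pi.single 0 (1 : K) : Fin 4 → K) + a 1 • Pi.single 1 1 +
          a 2 • Pi.single 2 1 + a 3 • Pi.single 3 1 := by
        funext j; fin_cases j <;> simp
      have e10 : σ 1 = σ 0 := by rw [← e21]; exact e20
      calc _ = a 0 • (X₀ (Pi.single 0 1) + X₁ (Pi.single 0 1)) +
            a 1 • (X₀ (Pi.single 1 1) + X₁ (Pi.single 1 1)) +
            a 2 • (X₀ (Pi.single 2 1) + X₁ (Pi.single 2 1)) +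
            a 3 • (X₀ (Pi.single 3 1) + X₁ (Pi.single 3 1)) := by
              simp only [smul_add]; abel
        _ = σ 0 • a := by
              rw [hS0, hS1, hS2, hS3, e10, e20, smul_comm (a 0), smul_comm (a 1),
                smul_comm (a 2), smul_comm (a 3), ← smul_add, ← smul_add, ← smul_add, ← ha]
    exact eq_sub_of_add_eq' hSa
  -- `X₂ c = -σ₀ c`
  have hX2 : X₂ c = -(σ 0 • c) := by
    have hz : X₂ c + σ 0 • c = 0 := by
      refine eq_zero_of_per_eq_zero₃ _ fun a b => ?_
      have f1 := (pencil_flow_orders X₀ X₁ X₂ μ h a b c hc).1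
      have f2 := (pencil_flow_orders X₀ X₁ X₂ μ h b a c hc).1
      have l1 : (Matrix.of ![(fun _ => (1 : K)), σ 0 • b - X₀ b, a, c]).permanent =
          σ 0 * (Matrix.of ![(fun _ => (1 : K)), a, b, c]).permanent -
            (Matrix.of ![(fun _ => (1 : K)), X₀ b, a, c]).permanent := by
        simp only [permanent_of_rows, Pi.sub_apply, Pi.smul_apply, smul_eq_mul]; ring
      have l2 : (Matrix.of ![(fun _ => (1 : K)), σ 0 • a - X₀ a, b, c]).permanent =
          σ 0 * (Matrix.of ![(fun _ => (1 : K)), a, b, c]).permanent -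
            (Matrix.of ![(fun _ => (1 : K)), X₀ a, b, c]).permanent := by
        simp only [permanent_of_rows, Pi.sub_apply, Pi.smul_apply, smul_eq_mul]; ring
      rw [hX1, per_swap₁₂ a (σ 0 • b - X₀ b), l1] at f1
      rw [hX1, per_swap₁₂ b (σ 0 • a - X₀ a), l2, per_swap₁₂ b a (X₂ c)] at f2
      rw [per_add_smul₃]
      linear_combination (f1 + f2) / 2
    exact eq_neg_of_add_eq_zero_left hz
  -- `σ₀ = 0` by nilpotency
  have hσ0 : σ 0 = 0 := by
    by_contra hs
    have E1 : ∀ b : Fin 4 → K, ∀ q : Fin 4,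
        σ 0 ^ 3 * b q - 3 * σ 0 ^ 2 * (X₀ b) q + 3 * σ 0 * (X₀ (X₀ b)) q = 0 := fun b q => by
      have h3 := congr_fun (X₁_cube_eq_zero X₀ X₁ X₂ μ h b) q
      have h0 := congr_fun (X₀_cube_eq_zero X₀ X₁ X₂ μ h b) q
      simp only [hX1, map_sub, map_smul, Pi.sub_apply, Pi.smul_apply, smul_eq_mul,
        Pi.zero_apply] at h3 h0
      linear_combination h3 + h0
    have hsq : ∀ b, X₀ (X₀ b) = 0 := fun b => by
      funext q
      have e := E1 (X₀ (X₀ b)) q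
      have z1 := congr_fun (X₀_cube_eq_zero X₀ X₁ X₂ μ h b) q
      have z2 := congr_fun (X₀_cube_eq_zero X₀ X₁ X₂ μ h (X₀ b)) q
      rw [Pi.zero_apply] at z1 z2
      rw [z1, z2, mul_zero, mul_zero, sub_zero, add_zero] at e
      have := (mul_eq_zero.1 e).resolve_left (pow_ne_zero 3 hs)
      simpa using this
    have hX0 : ∀ b, X₀ b = 0 := fun b => by
      funext q
      have e := E1 (X₀ b) q
      rw [hsq, map_zero, Pi.zero_apply, mul_zero, mul_zero, sub_zero, add_zero] at e
      have := (mul_eq_zero.1 e).resolve_left (pow_ne_zero 3 hs)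
      simpa using this
    have e := E1 (Pi.single 0 1) 0
    rw [hX0, map_zero] at e
    have h3 : σ 0 ^ 3 = 0 := by simpa using e
    exact hs ((pow_eq_zero_iff (by norm_num)).1 h3)
  rw [hX2, hσ0, zero_smul, neg_zero]

/-- **The hypothesis `hgen` of `SymPencilPerFourHyperplanePencilDispatch` holds**: PART X for every
`μ = (m₀, m₁, m₂, 0)` with `m₀m₁m₂ ≠ 0` off the four sign patterns (a zero-sum pair among
`m₀, m₁, m₂`, if any, is moved to `{0, 1}` by a coordinate permutation). [folklore] -/
theorem pencil_gen_holds :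
    ∀ (Y₀ Y₁ Y₂ : (Fin 4 → K) →ₗ[K] (Fin 4 → K)) (ν : (Fin 4 → K) →ₗ[K] K),
      ν (Pi.single 0 1) ≠ 0 → ν (Pi.single 1 1) ≠ 0 → ν (Pi.single 2 1) ≠ 0 →
      ν (Pi.single 3 1) = 0 →
      ¬ (ν (Pi.single 1 1) = ν (Pi.single 0 1) ∧ ν (Pi.single 2 1) = ν (Pi.single 0 1)) →
      ¬ (ν (Pi.single 1 1) = ν (Pi.single 0 1) ∧ ν (Pi.single 2 1) = -ν (Pi.single 0 1)) →
      ¬ (ν (Pi.single 1 1) = -ν (Pi.single 0 1) ∧ ν (Pi.single 2 1) = ν (Pi.single 0 1)) →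
      ¬ (ν (Pi.single 1 1) = -ν (Pi.single 0 1) ∧ ν (Pi.single 2 1) = -ν (Pi.single 0 1)) →
      (∀ (a b c : Fin 4 → K) (t : K), ν c = 0 →
        (Matrix.of ![(fun _ => (1 : K)), a + t • Y₀ a, b + t • Y₁ b, c + t • Y₂ c]).permanent =
          (Matrix.of ![(fun _ => (1 : K)), a, b, c]).permanent) →
      ∀ c, ν c = 0 → Y₂ c = 0 := by
  intro Y₀ Y₁ Y₂ ν h0 h1 h2 h3 n1 n2 n3 n4 hflow c hc
  by_cases s12 : ν (Pi.single 1 1) + ν (Pi.single 2 1) = 0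
  · have s01 : ν (Pi.single 1 1) + ν (Pi.single 0 1) ≠ 0 := fun h01 =>
      n3 ⟨by linear_combination h01, by linear_combination s12 - h01⟩
    have s02 : ν (Pi.single 2 1) + ν (Pi.single 0 1) ≠ 0 := fun h02 =>
      n2 ⟨by linear_combination s12 - h02, by linear_combination h02⟩
    have hne : ¬ (ν (Pi.single 2 1) = ν (Pi.single 1 1) ∧ ν (Pi.single 0 1) = ν (Pi.single 1 1)) :=
      fun hh => h1 (by linear_combination (s12 - hh.1) / 2)
    refine X₂_eq_zero_of_conj (Equiv.swap (0 : Fin 4) 2 * Equiv.swap (0 : Fin 4) 1) Y₂ ν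
      (fun c' hc' => ?_) c hc
    refine eq_zero_of_pencil_flow_one_zero _ _ _ _ ?_ ?_ ?_ ?_ ?_ ?_ ?_
      (pencil_flow_conj _ Y₀ Y₁ Y₂ ν hflow) c' hc'
    · rw [conj_single, show (Equiv.swap (0 : Fin 4) 2 * Equiv.swap (0 : Fin 4) 1) 0 = 1 from by decide]
      exact h1
    · rw [conj_single, show (Equiv.swap (0 : Fin 4) 2 * Equiv.swap (0 : Fin 4) 1) 1 = 2 from by decide]
      exact h2
    · rw [conj_single, show (Equiv.swap (0 : Fin 4) 2 * Equiv.swap (0 : Fin 4) 1) 2 = 0 from by decide]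
      exact h0
    · rw [conj_single, show (Equiv.swap (0 : Fin 4) 2 * Equiv.swap (0 : Fin 4) 1) 3 = 3 from by decide]
      exact h3
    · rw [conj_single, conj_single,
        show (Equiv.swap (0 : Fin 4) 2 * Equiv.swap (0 : Fin 4) 1) 1 = 2 from by decide,
        show (Equiv.swap (0 : Fin 4) 2 * Equiv.swap (0 : Fin 4) 1) 2 = 0 from by decide]
      exact s02
    · rw [conj_single, conj_single,
        show (Equiv.swap (0 : Fin 4) 2 * Equiv.swap (0 : Fin 4) 1) 0 = 1 from by decide,
        show (Equiv.swap (0 : Fin 4) 2 * Equiv.swap (0 : Fin 4) 1) 2 = 0 from by decide]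
      exact s01
    · rw [conj_single, conj_single, conj_single,
        show (Equiv.swap (0 : Fin 4) 2 * Equiv.swap (0 : Fin 4) 1) 0 = 1 from by decide,
        show (Equiv.swap (0 : Fin 4) 2 * Equiv.swap (0 : Fin 4) 1) 1 = 2 from by decide,
        show (Equiv.swap (0 : Fin 4) 2 * Equiv.swap (0 : Fin 4) 1) 2 = 0 from by decide]
      exact hne
  by_cases s02 : ν (Pi.single 0 1) + ν (Pi.single 2 1) = 0
  · have s01 : ν (Pi.single 0 1) + ν (Pi.single 1 1) ≠ 0 := fun h01 =>
      n4 ⟨by linear_combination h01, by linear_combination s02⟩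
    have hne : ¬ (ν (Pi.single 2 1) = ν (Pi.single 0 1) ∧ ν (Pi.single 1 1) = ν (Pi.single 0 1)) :=
      fun hh => h0 (by linear_combination (s02 - hh.1) / 2)
    have s21 : ν (Pi.single 2 1) + ν (Pi.single 1 1) ≠ 0 := fun hh => s12 (by linear_combination hh)
    refine X₂_eq_zero_of_conj (Equiv.swap (1 : Fin 4) 2) Y₂ ν (fun c' hc' => ?_) c hc
    refine eq_zero_of_pencil_flow_one_zero _ _ _ _ ?_ ?_ ?_ ?_ ?_ ?_ ?_
      (pencil_flow_conj _ Y₀ Y₁ Y₂ ν hflow) c' hc'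
    · rw [conj_single, show (Equiv.swap (1 : Fin 4) 2) 0 = 0 from by decide]; exact h0
    · rw [conj_single, show (Equiv.swap (1 : Fin 4) 2) 1 = 2 from by decide]; exact h2
    · rw [conj_single, show (Equiv.swap (1 : Fin 4) 2) 2 = 1 from by decide]; exact h1
    · rw [conj_single, show (Equiv.swap (1 : Fin 4) 2) 3 = 3 from by decide]; exact h3
    · rw [conj_single, conj_single, show (Equiv.swap (1 : Fin 4) 2) 1 = 2 from by decide,
        show (Equiv.swap (1 : Fin 4) 2) 2 = 1 from by decide]
      exact s21
    · rw [conj_single, conj_single, show (Equiv.swap (1 : Fin 4) 2) 0 = 0 from by decide,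
        show (Equiv.swap (1 : Fin 4) 2) 2 = 1 from by decide]
      exact s01
    · rw [conj_single, conj_single, conj_single, show (Equiv.swap (1 : Fin 4) 2) 0 = 0 from by decide,
        show (Equiv.swap (1 : Fin 4) 2) 1 = 2 from by decide,
        show (Equiv.swap (1 : Fin 4) 2) 2 = 1 from by decide]
      exact hne
  exact eq_zero_of_pencil_flow_one_zero Y₀ Y₁ Y₂ ν h0 h1 h2 h3 s12 s02 n1 hflow c hc

/-! ### The unconditional S1c -/

/-- **PART X**: for every `μ ≠ 0` the pencil flow forces `X₂ = 0` on `ker μ`. [folklore] -/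
theorem X₂_eq_zero_of_pencil_flow (X₀ X₁ X₂ : (Fin 4 → K) →ₗ[K] (Fin 4 → K))
    (μ : (Fin 4 → K) →ₗ[K] K) (hμ : μ ≠ 0)
    (h : ∀ (a b c : Fin 4 → K) (t : K), μ c = 0 →
      (Matrix.of ![(fun _ => (1 : K)), a + t • X₀ a, b + t • X₁ b, c + t • X₂ c]).permanent =
        (Matrix.of ![(fun _ => (1 : K)), a, b, c]).permanent)
    (c : Fin 4 → K) (hc : μ c = 0) : X₂ c = 0 :=
  X₂_eq_zero_of_pencil_flow_of_gen pencil_gen_holds X₀ X₁ X₂ μ hμ h c hc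

/-- **Stub S1c of cell `(12,4,2)` — the one-row pencil core of `RIG_𝟙`, UNCONDITIONAL** (signature
of record, val-width bus 2026-08-28 14:50Z): if `μ ≠ 0` and
`per [𝟙; a + tX₀a; b + tX₁b; c + tX₂c] = per [𝟙; a; b; c]` for all `a, b`, all `c ∈ ker μ` and all
`t`, then `X₀, X₁` vanish on a common hyperplane `ker φ` (or identically, `φ = 0`) and `X₂`
vanishes on `ker μ`. [folklore] -/
theorem exists_kernel_hyperplane_of_pencil_flow (X₀ X₁ X₂ : (Fin 4 → K) →ₗ[K] (Fin 4 → K))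
    (μ : (Fin 4 → K) →ₗ[K] K) (hμ : μ ≠ 0)
    (h : ∀ (a b c : Fin 4 → K) (t : K), μ c = 0 →
      (Matrix.of ![(fun _ => (1 : K)), a + t • X₀ a, b + t • X₁ b, c + t • X₂ c]).permanent =
        (Matrix.of ![(fun _ => (1 : K)), a, b, c]).permanent) :
    ∃ φ : (Fin 4 → K) →ₗ[K] K,
      (∀ a, φ a = 0 → X₀ a = 0 ∧ X₁ a = 0) ∧ (∀ c, μ c = 0 → X₂ c = 0) :=
  exists_kernel_hyperplane_of_pencil_flow_of_gen pencil_gen_holds X₀ X₁ X₂ μ hμ h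

/-- **The good point of `RIG_𝟙` for the block-diagonal one-row flow, UNCONDITIONAL**: there are
`a, b` and `c ∈ ker μ` with `X₀ a = X₁ b = X₂ c = 0` and `per [𝟙; a; b; c] ≠ 0`. [folklore] -/
theorem exists_good_point_of_pencil_flow (X₀ X₁ X₂ : (Fin 4 → K) →ₗ[K] (Fin 4 → K))
    (μ : (Fin 4 → K) →ₗ[K] K) (hμ : μ ≠ 0)
    (h : ∀ (a b c : Fin 4 → K) (t : K), μ c = 0 →
      (Matrix.of ![(fun _ => (1 : K)), a + t • X₀ a, b + t • X₁ b, c + t • X₂ c]).permanent =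
        (Matrix.of ![(fun _ => (1 : K)), a, b, c]).permanent) :
    ∃ a b c : Fin 4 → K, μ c = 0 ∧ X₀ a = 0 ∧ X₁ b = 0 ∧ X₂ c = 0 ∧
      (Matrix.of ![(fun _ => (1 : K)), a, b, c]).permanent ≠ 0 :=
  exists_good_point_of_pencil_flow_of_gen pencil_gen_holds X₀ X₁ X₂ μ hμ h

end Summit.ValiantsHypothesis.ValiantsHypothesis.Theorems.SymPencilPerFourHyperplanePencilZeroOne
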